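import Literature.IUT.HodgeTheaters.ThetaNFHodgeTheaters
import Literature.IUT.HodgeTheaters.BaseHodgeTheatersProofs2
import HarnessLib

/-!
# ΘNF-Hodge theaters: kernel evidence for referee finding G16-F1 on Corollary 5.6 (ii) ([IUTchI] p. 153–154) —
# abc-iut cell, layer L5 (proof-only companion of `ThetaNFHodgeTheaters.lean`)

Mochizuki, *Inter-universal Teichmüller theory I*, §5 (kurims May-2020 manuscript). The statement `Cor56ii_HT` of
`ThetaNFHodgeTheaters.lean` maps an isomorphism of ΘNF-Hodge theaters to the bare PAIR of its underlying
`𝒟`-NF-bridge / `𝒟`-Θ-bridge isomorphisms, whereas print (Cor. 5.6 (ii)) speaks of the isomorphisms of the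
ASSOCIATED `𝒟`-ΘNF-Hodge theaters — pairs inducing the SAME bijection of index sets (Def. 4.6 (iii)). Referee
finding ref-g G16-F1 (2026-08-25) observed that the bare-product form is refutable; this file PROVES it:

* `exists_dNFBridgeHom_ι_ne`: between any two `𝒟`-NF-bridges there are two isomorphisms with DIFFERENT index
  bijections (Prop. 4.8 (i): they form an `F_l^⋇`-torsor, `l^⋇ = (l-1)/2 ≥ 2` since `l ≥ 5`);
* `not_cor56ii_HT`: hence `Cor56ii_HT H H'` is FALSE for every pair of ΘNF-Hodge theaters over every stub — the
  pairs `(n, t)` with `n.ι ≠ t.ι` are never induced (an induced pair satisfies `compat`), while the underlying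
  `𝒟`-Θ-bridges have exactly one isomorphism `t` (Prop. 4.8 (ii)).

The repaired statement is `Cor56ii_HTR` (codomain `DThetaNFHodgeTheater.Hom`, appended to `ThetaNFHodgeTheaters.lean` by the
revision p409300; now landed; its conditional discharge is `cor56ii_HTR_of_baseGIso_bijective` at the end of this file).
Proof-only companion; record-only, [claim: Mochizuki2012, status: disputed]; nothing here takes a side — the
refuted declaration is a mis-transcription of ours, not a statement of print.
-/

namespace Literature.IUT.HodgeTheaters

open CategoryTheory

universe u

namespace BaseThetaDatum

variable {𝔡 : BaseThetaDatum.{u}}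

/-- Prop. 4.8 (i) ⇒ between two `𝒟`-NF-bridges there exist two isomorphisms with different bijections of index
sets (`l^⋇ ≥ 2` of them exist, one per element of `F_l^⋇`). [claim: Mochizuki2012, status: disputed] -/
theorem exists_dNFBridgeHom_ι_ne (B B' : 𝔡.DNFBridge) :
    ∃ n₁ n₂ : DNFBridge.Hom 𝔡 B B', n₁.ι ≠ n₂.ι := by
  obtain ⟨-, -, hcard⟩ := prop48i_holds B B'
  have h2 : 1 < Nat.card {ι : B.J ≃ B'.J // ∃ φ : DNFBridge.Hom 𝔡 B B', φ.ι = ι} := by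
    rw [hcard]
    exact two_le_lStar 𝔡.five_le_l
  haveI : Finite {ι : B.J ≃ B'.J // ∃ φ : DNFBridge.Hom 𝔡 B B', φ.ι = ι} :=
    Nat.finite_of_card_ne_zero (by omega)
  obtain ⟨⟨ι₁, φ₁, h₁⟩, ⟨ι₂, φ₂, h₂⟩, hne⟩ := (Finite.one_lt_card_iff_nontrivial.mp h2).exists_pair_ne
  refine ⟨φ₁, φ₂, fun h => hne (Subtype.ext ?_)⟩
  change ι₁ = ι₂
  rw [← h₁, ← h₂]
  exact h

namespace S5Local

variable {S : S5Local 𝔡}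

/-- Every INDUCED pair of underlying isomorphisms has equal index bijections (Def. 5.5 (iii), `compat`) — the image of
the map of `Cor56ii_HT` lies in the associated `𝒟`-ΘNF-Hodge-theater isomorphisms. [claim: Mochizuki2012, status: disputed] -/
theorem ThetaNFHodgeTheater.Hom.nf_under_ι {H H' : ThetaNFHodgeTheater S} (φ : ThetaNFHodgeTheater.Hom H H') :
    φ.nf.under.ι = φ.theta.under.ι :=
  φ.compat

/-- **G16-F1, kernel evidence**: the bare-product form `Cor56ii_HT` of Cor. 5.6 (ii) is FALSE for every pair of
ΘNF-Hodge theaters `H`, `H'` over every stub `S` — with `t` the unique isomorphism of the underlying `𝒟`-Θ-bridges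
(Prop. 4.8 (ii)) and `n₁`, `n₂` isomorphisms of the underlying `𝒟`-NF-bridges with different index bijections
(Prop. 4.8 (i)), the pairs `(n₁, t)`, `(n₂, t)` cannot both be induced. The print-faithful statement is `Cor56ii_HTR`.
[claim: Mochizuki2012, status: disputed] -/
theorem not_cor56ii_HT (H H' : ThetaNFHodgeTheater S) : ¬ Cor56ii_HT H H' := by
  intro h
  obtain ⟨n₁, n₂, hne⟩ := exists_dNFBridgeHom_ι_ne H.toNFBridge.under H'.toNFBridge.under
  obtain ⟨t⟩ := DThetaBridge.Hom.nonempty H.toThetaBridge.under H'.toThetaBridge.under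
  obtain ⟨φ₁, h₁⟩ := h.2 (n₁, t)
  obtain ⟨φ₂, h₂⟩ := h.2 (n₂, t)
  have e₁ : φ₁.nf.under = n₁ := congrArg Prod.fst h₁
  have f₁ : φ₁.theta.under = t := congrArg Prod.snd h₁
  have e₂ : φ₂.nf.under = n₂ := congrArg Prod.fst h₂
  have f₂ : φ₂.theta.under = t := congrArg Prod.snd h₂
  have c₁ : φ₁.nf.under.ι = φ₁.theta.under.ι := φ₁.compat
  have c₂ : φ₂.nf.under.ι = φ₂.theta.under.ι := φ₂.compat
  rw [e₁, f₁] at c₁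
  rw [e₂, f₂] at c₂
  exact hne (c₁.trans c₂.symm)

/-- Consequently the set of pairs NOT in the image of the `Cor56ii_HT` map is nonempty whenever there are two
ΘNF-Hodge theaters: surjectivity is what fails (injectivity is untouched by the finding). [claim: Mochizuki2012, status: disputed] -/
theorem cor56ii_HT_not_surjective (H H' : ThetaNFHodgeTheater S) :
    ¬ Function.Surjective (fun φ : ThetaNFHodgeTheater.Hom H H' => (φ.nf.under, φ.theta.under)) := by
  intro hs
  obtain ⟨n₁, n₂, hne⟩ := exists_dNFBridgeHom_ι_ne H.toNFBridge.under H'.toNFBridge.under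
  obtain ⟨t⟩ := DThetaBridge.Hom.nonempty H.toThetaBridge.under H'.toThetaBridge.under
  obtain ⟨φ₁, h₁⟩ := hs (n₁, t)
  obtain ⟨φ₂, h₂⟩ := hs (n₂, t)
  have e₁ : φ₁.nf.under = n₁ := congrArg Prod.fst h₁
  have f₁ : φ₁.theta.under = t := congrArg Prod.snd h₁
  have e₂ : φ₂.nf.under = n₂ := congrArg Prod.fst h₂
  have f₂ : φ₂.theta.under = t := congrArg Prod.snd h₂
  have c₁ : φ₁.nf.under.ι = φ₁.theta.under.ι := φ₁.compat
  have c₂ : φ₂.nf.under.ι = φ₂.theta.under.ι := φ₂.compat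
  rw [e₁, f₁] at c₁
  rw [e₂, f₂] at c₂
  exact hne (c₁.trans c₂.symm)

/-! ### Corollary 5.6 (ii) for NF-bridges and ΘNF-Hodge theaters GIVEN Corollary 5.3 (i)

Print (p. 154): "assertions (ii), (iii) follow immediately from the definitions and Corollary 5.3, (i), (ii)".
Cor. 5.3 (i) (p. 144: "the natural map `Isom(¹ℱ^⊚, ²ℱ^⊚) → Isom(Base(¹ℱ^⊚), Base(²ℱ^⊚))` … is bijective") is, in the
vocabulary of the stub `S5Local`, the bijectivity of `S.baseGIso` on every pair of isomorphs of `ℱ^⊚`; it is abc-iut-L5-t4's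
node ([IUTchI] Cor. 5.3 (i), `FPrimeStrips*.lean`; TODO-merge:abc-iut-L5-t4) and enters below as an explicit HYPOTHESIS
`hrig` — an honest conditional discharge, non-vacuous (any stub whose `baseG`/`baseGIso` is an isomorphism-reflecting
functor, e.g. the identity on a common ambient category, satisfies it). -/

/-- **Corollary 5.6 (ii) for NF-bridges, GIVEN Cor. 5.3 (i) for `ℱ^⊚`** ([IUTchI] p. 153–154; proof p. 154 "follow[s]
immediately from the definitions and Corollary 5.3, (i), (ii)"): if every isomorphism of base categories
`Base(¹ℱ^⊚) ⥲ Base(²ℱ^⊚)` lifts UNIQUELY to `¹ℱ^⊚ ⥲ ²ℱ^⊚` (`hrig`: `S.baseGIso` bijective — [IUTchI] Cor. 5.3 (i) p. 144 in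
the stub's vocabulary, TODO-merge:abc-iut-L5-t4), then the natural map from isomorphisms of NF-bridges to isomorphisms
of the associated `𝒟`-NF-bridges is bijective: the poly-isomorphism `¹ℱ^⊚ ⥲ ²ℱ^⊚` over a given `Aut_ε`-orbit of base
isomorphisms is exactly its preimage. [claim: Mochizuki2012, status: disputed] -/
theorem cor56ii_NF_of_baseGIso_bijective
    (hrig : ∀ Y Y' : S.FAmbG, Function.Bijective (S.baseGIso : (Y ≅ Y') → (S.baseG Y ≅ S.baseG Y')))
    (B B' : NFBridge S) : Cor56ii_NF B B' := by
  have key : ∀ {P Q : PolyIso B.globF B'.globF},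
      {b | ∃ e ∈ P, S.baseGIso e = b} = {b | ∃ e ∈ Q, S.baseGIso e = b} → P ⊆ Q := by
    intro P Q hPQ e he
    have hb : S.baseGIso e ∈ {b | ∃ e ∈ Q, S.baseGIso e = b} := by
      rw [← hPQ]
      exact ⟨e, he, rfl⟩
    obtain ⟨e', he', hee'⟩ := hb
    rwa [← (hrig _ _).1 hee']
  constructor
  · rintro ⟨P, u, hP⟩ ⟨Q, u', hQ⟩ (h : u = u')
    subst h
    obtain rfl : P = Q := Set.Subset.antisymm (key (hP.symm.trans hQ)) (key (hQ.symm.trans hP))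
    rfl
  · intro u
    refine ⟨⟨{e | S.baseGIso e ∈ u.orbit}, u, ?_⟩, rfl⟩
    ext b
    constructor
    · intro hb
      obtain ⟨e, rfl⟩ := (hrig _ _).2 b
      exact ⟨e, hb, rfl⟩
    · rintro ⟨e, he, rfl⟩
      exact he

/-- Without any hypothesis, the natural map of Cor. 5.6 (ii) for NF-bridges is INJECTIVE as soon as `S.baseGIso` is
(uniqueness of liftings); surjectivity is what consumes the existence half of Cor. 5.3 (i). [claim: Mochizuki2012, status: disputed] -/
theorem cor56ii_NF_injective_of_baseGIso_injective
    (hinj : ∀ Y Y' : S.FAmbG, Function.Injective (S.baseGIso : (Y ≅ Y') → (S.baseG Y ≅ S.baseG Y')))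
    (B B' : NFBridge S) : Function.Injective (fun φ : NFBridge.Hom B B' => φ.under) := by
  have key : ∀ {P Q : PolyIso B.globF B'.globF},
      {b | ∃ e ∈ P, S.baseGIso e = b} = {b | ∃ e ∈ Q, S.baseGIso e = b} → P ⊆ Q := by
    intro P Q hPQ e he
    have hb : S.baseGIso e ∈ {b | ∃ e ∈ Q, S.baseGIso e = b} := by
      rw [← hPQ]
      exact ⟨e, he, rfl⟩
    obtain ⟨e', he', hee'⟩ := hb
    rwa [← hinj _ _ hee']
  rintro ⟨P, u, hP⟩ ⟨Q, u', hQ⟩ (h : u = u')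
  subst h
  obtain rfl : P = Q := Set.Subset.antisymm (key (hP.symm.trans hQ)) (key (hQ.symm.trans hP))
  rfl

/-! ### Corollary 5.6 (i) GIVEN its two printed inputs

Print (p. 154): "the only data [of a Θ-Hodge theater] that is not contained in the associated `ℱ`-prime-strip `†ℱ_>` … is
the global data of Definition 3.6, (c) [obtained by the functorial algorithm `‡ℱ ↦ ‡ℱ^⊩` of Remark 5.2.1, (ii)], and
the tempered Frobenioids … at the `v ∈ 𝕍^bad` [Cor. 5.3 (iv)] … Thus, assertion (i) follows by applying Corollary 5.3,
(ii), to the associated `ℱ`-prime-strips". In the stub's vocabulary: (`hHT`) an isomorphism of Θ-Hodge theaters is the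
same datum as a family of isomorphisms of the constituents of the associated `ℱ`-prime-strips (TODO-merge:abc-iut-L5-t2
Def. 3.6 / abc-iut-L5-t4 Def. 5.2 (iv), Rmk 5.2.1 (ii)); (`hbase`) Cor. 5.3 (ii) constituent-wise: `ℱ_v` is rigid over
`𝒟_v` (TODO-merge:abc-iut-L5-t4 Cor. 5.3 (ii)). -/

/-- Components of an isomorphism of families assembled by `Pi.isoMk` (Mathlib plumbing). [folklore] -/
private theorem isoApp_isoMk {I : Type*} {C : I → Type*} [∀ i, Category (C i)] {X Y : ∀ i, C i}
    (f : ∀ i, X i ≅ Y i) (i : I) : Pi.isoApp (Pi.isoMk f) i = f i :=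
  Iso.ext rfl

variable (S) in
/-- **Corollary 5.6 (i), GIVEN its printed inputs** ([IUTchI] p. 153, proof p. 154): if (`hHT`) isomorphisms of Θ-Hodge
theaters correspond bijectively to families of isomorphisms of the constituents of their associated `ℱ`-prime-strips
(Def. 3.6 sorted against Def. 5.2 (iv) via Rmk. 5.2.1 (ii) and Cor. 5.3 (iv)) and (`hbase`) every `ℱ_v` is rigid over its
base `𝒟_v` (Cor. 5.3 (ii), constituent-wise), then the natural map from isomorphisms of Θ-Hodge theaters to isomorphisms
of the associated `𝒟`-prime-strips is bijective. [claim: Mochizuki2012, status: disputed] -/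
theorem cor56i_of_rigid
    (hHT : ∀ X Y : S.ThetaHT, Function.Bijective (fun e : X ≅ Y => fun v => S.assocStripIso e v))
    (hbase : ∀ v (A B : S.FAmb v),
      Function.Bijective ((S.base v).mapIso : (A ≅ B) → ((S.base v).obj A ≅ (S.base v).obj B))) :
    Cor56i S := by
  intro X Y
  constructor
  · intro e e' h
    apply (hHT X Y).1
    funext v
    apply (hbase v _ _).1
    have hv := congrArg (fun g => Pi.isoApp g v) h
    simp only [isoApp_isoMk] at hv
    exact hv
  · intro g
    choose a ha using fun v => (hbase v _ _).2 (Pi.isoApp g v)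
    obtain ⟨e, he⟩ := (hHT X Y).2 a
    refine ⟨e, Iso.ext (funext fun v => ?_)⟩
    have hv : (S.base v).mapIso (S.assocStripIso e v) = Pi.isoApp g v := by
      rw [show S.assocStripIso e v = a v from congrFun he v, ha]
    change ((S.base v).mapIso (S.assocStripIso e v)).hom = g.hom v
    rw [hv]
    rfl

/-! ### Corollary 5.6 (ii) for ΘNF-Hodge theaters (repaired statement `Cor56ii_HTR`, revision p409300) GIVEN Cor. 5.3 (i) -/

/-- **Corollary 5.6 (ii) for ΘNF-Hodge theaters (repaired form `Cor56ii_HTR`), GIVEN Cor. 5.3 (i) for `ℱ^⊚`**: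
combine `cor56ii_NF_of_baseGIso_bijective` with `cor56ii_HTR_of_NF` (the Θ-component is rigid, Prop. 4.8 (ii)).
[claim: Mochizuki2012, status: disputed] -/
theorem cor56ii_HTR_of_baseGIso_bijective
    (hrig : ∀ Y Y' : S.FAmbG, Function.Bijective (S.baseGIso : (Y ≅ Y') → (S.baseG Y ≅ S.baseG Y')))
    (H H' : ThetaNFHodgeTheater S) : Cor56ii_HTR H H' :=
  cor56ii_HTR_of_NF H H' (cor56ii_NF_of_baseGIso_bijective hrig _ _)

end S5Local

end BaseThetaDatum

end Literature.IUT.HodgeTheaters
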